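import Summits.RiemannHypothesis.RiemannHypothesis.Theorems.GroundBartaEvenWinsBeyondArchDeflationRitz
import Summits.RiemannHypothesis.RiemannHypothesis.Theorems.GroundBartaEvenWinsBeyondArchDeflationPSD
import Literature.NumberTheory.LFunctions.WeilTwoPrimeCertificateDeflatedSector
import Literature.NumberTheory.LFunctions.WeilTwoPrimeQuadratic
import HarnessLib

/-!
# RiemannHypothesis / GroundBarta — rung 4 (`EvenWinsBeyondArch`, stmt-RiemannHypothesis-18807):
# the deflated Temple (Lehmann–Maehly) L-side programme, XI — from a CHECKED deflated moment certificate to `ε_ev`, `ε_od`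

Helper file (`--supports stmt-RiemannHypothesis-18807`), RH-free, Mathlib + landed tree files only, no
definitions, no named facts.

The capstone glue of the programme.  A rank-one augmented two-prime moment certificate `cert : WeilCert23` with
`cert.checkR₁ β R p = true` (`Literature/NumberTheory/LFunctions/WeilTwoPrimeCertificateDeflatedSector.lean`: soundness
`β‖φ‖² ≤ E₂₃(φ) + Σ_{r∈R} μ_r |Σ_k ĉ_{rk} M_k(φ)|²` for tests of parity `p` on `C(b)`) IS the complement certificate `hcert`
of the deflated Temple bound for the polynomial trial vectors `v_r = g_r 𝟙_{[-b,b]}`, `g_r(x) = Σ_k ĉ_{rk}(x/a₀)^k`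
(`E₂₃ = Re Q` on `C(log 2)`, `Σ_k ĉ_{rk} M_k(φ) = ∫ φ v̄_r`).  Hence (`dt_sector_bound_of_checkR₁`, `dt_weilEvenGroundEnergy_ge_of_checkR₁`,
`dt_weilOddGroundEnergy_ge_of_checkR₁`): CHECKED CERTIFICATE + the explicit `k × k` PSD inequality on the window images
⇒ `λ ≤ ε_ev(b)` / `λ ≤ ε_od(b)`; and, with file XII (`dt_psd_of_certificate`), the ALL-FINITE-DATA form
`dt_weil{Even,Odd}GroundEnergy_ge_of_certificates`: checked moment certificate + rational `(P, E, D, L, δ)` + the `k²` entrywise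
enclosures `|M_ij − P_ij| ≤ E_ij` ⇒ `λ ≤ ε_sector(b)`.  What a certificate seat still supplies: the data `cert, R` (generator), `checkR₁ = true`
(kernel evaluation, split into row files as for certificates K/H), and the PSD inequality (interval enclosures of `A`, `G`,
`∫F_iF_j`; files V–VIII give `F_i` and all analytic side conditions).  Prover B, speedrun unit `sr-gb-rung-b` (gen 3).

References: H. Yoshida, Adv. Stud. Pure Math. 21 (1992) Thm 1; A. Weinstein, W. Stenger (1972) Ch. 5 §9; E. Bombieri, Rend.
Mat. Acc. Lincei (9) 11 (2000) Thm 2, §4.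
-/

set_option linter.dupNamespace false

noncomputable section

open MeasureTheory Set Filter Finset
open scoped Topology ENNReal NNReal ComplexConjugate BigOperators

namespace Summit.RiemannHypothesis.RiemannHypothesis.Theorems.EvenWinsBeyondArch

open Literature.NumberTheory.LFunctions
open Summit.RiemannHypothesis.RiemannHypothesis.Theorems.OddSector (weilDirichletEnergy₂ weilPoleForm₂)

/-! ## The polynomial trial vectors of a rank-one certificate -/

/-- Parity of the masked coefficients: `ĉ_k (−1)^k = (−1)^q ĉ_k`. -/
theorem dt_maskV_neg_one_pow (r : ℚ × ℕ × List ℚ) (k : ℕ) :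
    (maskV r k : ℝ) * (-1) ^ k = (-1) ^ r.2.1 * (maskV r k : ℝ) := by
  unfold maskV
  by_cases hk : k % 2 = r.2.1 % 2
  · rw [if_pos hk, neg_one_pow_eq_pow_mod_two (R := ℝ) (n := k), neg_one_pow_eq_pow_mod_two (R := ℝ) (n := r.2.1), hk]
    ring
  · rw [if_neg hk]; push_cast; ring

/-- The polynomial `g_r(x) = Σ_{k ≤ N} ĉ_{rk} (x/a₀)^k` of a rank-one term has the parity of the term:
`g_r(−x) = (−1)^q g_r(x)`. -/
theorem dt_poly_parity (r : ℚ × ℕ × List ℚ) (n : ℕ) (a₀ x : ℝ) :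
    ∑ k ∈ range n, (maskV r k : ℝ) * (-x / a₀) ^ k = (-1) ^ r.2.1 * ∑ k ∈ range n, (maskV r k : ℝ) * (x / a₀) ^ k := by
  rw [Finset.mul_sum]
  refine Finset.sum_congr rfl fun k _ ↦ ?_
  rw [show (-x / a₀) ^ k = (-1) ^ k * (x / a₀) ^ k by rw [neg_div, neg_eq_neg_one_mul, mul_pow], ← mul_assoc,
    dt_maskV_neg_one_pow]
  ring

/-- **Moments of the polynomial = the pairing with the trial vector**: for a test `φ` supported in `[-b, b]`,
`Σ_k ĉ_k M_k(φ) = ∫ φ · conj(g 𝟙_{[-b,b]})` with `g(x) = Σ_k ĉ_k (x/a₀)^k`. -/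
theorem dt_sum_weilMoment_eq_pairing (r : ℚ × ℕ × List ℚ) (n : ℕ) (a₀ : ℝ) {b : ℝ} {φ : ℝ → ℂ} (hφ : IsWeilTest φ)
    (hφs : tsupport φ ⊆ Icc (-b) b) {v : ℝ → ℂ}
    (hv : ∀ x, v x = (((Icc (-b) b).indicator (fun x ↦ ∑ k ∈ range n, (maskV r k : ℝ) * (x / a₀) ^ k) x : ℝ) : ℂ)) :
    ∑ k ∈ range n, ((maskV r k : ℚ) : ℂ) * weilMoment a₀ φ k = ∫ x, φ x * conj (v x) := by
  have hint : ∀ k, Integrable fun x ↦ φ x * ((((x / a₀) ^ k : ℝ)) : ℂ) := fun k ↦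
    hφ.integrable_mul (by fun_prop)
  unfold weilMoment
  simp_rw [← integral_const_mul]
  rw [← integral_finsetSum _ fun k _ ↦ (hint k).const_mul _]
  refine integral_congr_ae (Eventually.of_forall fun x ↦ ?_)
  dsimp only
  by_cases hx : x ∈ Icc (-b) b
  · rw [hv x, indicator_of_mem hx, Complex.conj_ofReal]
    push_cast
    rw [Finset.mul_sum]
    refine Finset.sum_congr rfl fun k _ ↦ by ring
  · have hφ0 : φ x = 0 := image_eq_zero_of_notMem_tsupport fun h ↦ hx (hφs h)
    simp [hφ0]

/-- A list sum over the rank-one terms as a `Fin`-indexed sum. -/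
theorem dt_list_sum_map_eq_sum_fin {α : Type*} (R : List α) (f : α → ℝ) :
    (R.map f).sum = ∑ i : Fin R.length, f (R.get i) := by
  conv_lhs => rw [← List.ofFn_get R]
  rw [List.map_ofFn, Fin.sum_ofFn]
  rfl

/-! ## From a checked sector certificate to the sector bound -/

/-- **The deflated Temple bound from a CHECKED rank-one certificate (parity `p`).**  Let `cert.checkR₁ β R p = true` with
all rank-one terms of parity `p` and `μ_r ≥ 0`, `b = cert.b ≤ log 2` the window; `g_i`, `v_i`, `F_i` the polynomial trial
vectors of `R` and their explicit window images; `W`, `λ < β`; and the `k × k` PSD inequality.  Then every test `φ` of parity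
`p` on `[-b, b]` obeys `λ ∫|φ|² ≤ Re Q(φ)`. [cite: Yoshida1992, Thm 1 (moment certificates)] -/
theorem dt_sector_bound_of_checkR₁ (cert : WeilCert23) {β : ℚ} {R : List (ℚ × ℕ × List ℚ)} {p : ℕ}
    (hcheck : cert.checkR₁ β R p = true) (hμ : ∀ i : Fin R.length, 0 ≤ (R.get i).1)
    (hRp : ∀ i : Fin R.length, (R.get i).2.1 % 2 = p % 2) (hb0 : 0 < (cert.b : ℝ)) (hb2 : (cert.b : ℝ) ≤ Real.log 2)
    (g : Fin R.length → ℝ → ℝ)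
    (hg : ∀ i x, g i x = ∑ k ∈ range (cert.base.N + 1), (maskV (R.get i) k : ℝ) * (x / cert.base.a0) ^ k)
    (v F : Fin R.length → ℝ → ℂ) (hv : ∀ i x, v i x = (((Icc (-(cert.b : ℝ)) cert.b).indicator (g i) x : ℝ) : ℂ))
    (hF : ∀ i y, F i y = (Icc (-(cert.b : ℝ)) cert.b).indicator (fun y ↦
        2 * (∫ x, v i x * (Real.cosh (x / 2) : ℂ)) * (Real.cosh (y / 2) : ℂ) -
          2 * (∫ x, v i x * (Real.sinh (x / 2) : ℂ)) * (Real.sinh (y / 2) : ℂ) +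
        (∑ n ∈ weilPrimeIndex (cert.b : ℝ), (((ArithmeticFunction.vonMangoldt n : ℝ) / Real.sqrt n : ℝ) : ℂ) *
          (2 * v i y - v i (y - Real.log n) - v i (y + Real.log n))) +
        ∫ t in Ioi 0, (weilArchDensity t : ℂ) * (2 * v i y - v i (y - t) - v i (y + t))) y -
      (weilMarkovConstant (cert.b : ℝ) : ℂ) * v i y)
    (W : Fin R.length → Fin R.length → ℝ) {lam : ℝ} (hlam : lam < (β : ℝ))
    (hPSD : ∀ α : Fin R.length → ℝ, 0 ≤ ∑ i, ∑ j, α i * α j *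
      (((β : ℝ) - lam) * ((weilPoleForm₂ (v i) (v j) + weilDirichletEnergy₂ (cert.b : ℝ) (v i) (v j) -
          weilMarkovConstant (cert.b : ℝ) * ∫ x, (v i x * conj (v j x)).re) - lam * ∫ x, (v i x * conj (v j x)).re) -
        ∫ x, ((F i - ∑ l, W i l • v l) x * conj ((F j - ∑ l, W j l • v l) x)).re))
    {φ : ℝ → ℂ} (hφ : IsWeilTest φ) (hφs : tsupport φ ⊆ Icc (-(cert.b : ℝ)) cert.b)
    (hφp : ∀ x, φ (-x) = (((-1 : ℝ) ^ p : ℝ) : ℂ) * φ x) :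
    lam * ∫ x, ‖φ x‖ ^ 2 ≤ (weilQuadratic φ).re := by
  set c : ℝ := (cert.b : ℝ) with hc
  have hgf : ∀ i, g i = fun x ↦ ∑ k ∈ range (cert.base.N + 1), (maskV (R.get i) k : ℝ) * (x / cert.base.a0) ^ k :=
    fun i ↦ funext (hg i)
  -- the certificate as `hcert`
  have hcert : ∀ ψ : ℝ → ℂ, IsWeilTest ψ → tsupport ψ ⊆ Icc (-c) c → (∀ x, ψ (-x) = (((-1 : ℝ) ^ p : ℝ) : ℂ) * ψ x) →
      (β : ℝ) * ∫ x, ‖ψ x‖ ^ 2 ≤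
        (weilQuadratic ψ).re + ∑ i, ((R.get i).1 : ℝ) * ‖∫ x, ψ x * conj (v i x)‖ ^ 2 := by
    intro ψ hψ hψs hψp
    have h := WeilCert23.weilTwoPrimeQuadratic_rankOne_bound_of_checkR₁ hcheck hψ hψs
      (fun x ↦ by have e := hψp x; push_cast at e; exact e)
    have hsupp2 : tsupport ψ ⊆ Icc (-Real.log 2) (Real.log 2) := hψs.trans (Icc_subset_Icc (by linarith) hb2)
    rw [← weilQuadratic_re_eq_weilTwoPrimeQuadratic hψ hsupp2, dt_list_sum_map_eq_sum_fin] at h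
    have e : ∀ i : Fin R.length, ‖∑ k ∈ range (cert.base.N + 1), ((maskV (R.get i) k : ℚ) : ℂ) *
        weilMoment cert.base.a0 ψ k‖ ^ 2 = ‖∫ x, ψ x * conj (v i x)‖ ^ 2 := by
      intro i
      rw [dt_sum_weilMoment_eq_pairing (R.get i) _ _ hψ hψs (v := v i) (fun x ↦ by rw [hv i x, hgf i])]
    simp only [e] at h
    exact h
  refine dt_sector_bound_of_ritz hb0 ((-1 : ℝ) ^ p) g (fun i ↦ ?_) (fun i x ↦ ?_) v F hv hF W
    (fun i ↦ ((R.get i).1 : ℝ)) hlam (fun i ↦ by exact_mod_cast hμ i) hcert hPSD hφ hφs hφp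
  · rw [hgf i]
    exact ContDiff.sum fun k _ ↦ contDiff_const.mul ((contDiff_id.div_const _).pow k)
  · rw [hg i, hg i, dt_poly_parity, neg_one_pow_eq_pow_mod_two (R := ℝ) (n := (R.get i).2.1), hRp i,
      ← neg_one_pow_eq_pow_mod_two]

/-- **`λ ≤ ε_ev(b)` from a checked EVEN rank-one certificate** (parity `p = 0`) plus the PSD inequality.
[cite: WeinsteinStenger1972, Ch. 5 §9 eq. (2) (k = 1: Temple's formula)] -/
theorem dt_weilEvenGroundEnergy_ge_of_checkR₁ (cert : WeilCert23) {β : ℚ} {R : List (ℚ × ℕ × List ℚ)}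
    (hcheck : cert.checkR₁ β R 0 = true) (hμ : ∀ i : Fin R.length, 0 ≤ (R.get i).1)
    (hRp : ∀ i : Fin R.length, (R.get i).2.1 % 2 = 0) (hb0 : 0 < (cert.b : ℝ)) (hb2 : (cert.b : ℝ) ≤ Real.log 2)
    (g : Fin R.length → ℝ → ℝ)
    (hg : ∀ i x, g i x = ∑ k ∈ range (cert.base.N + 1), (maskV (R.get i) k : ℝ) * (x / cert.base.a0) ^ k)
    (v F : Fin R.length → ℝ → ℂ) (hv : ∀ i x, v i x = (((Icc (-(cert.b : ℝ)) cert.b).indicator (g i) x : ℝ) : ℂ))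
    (hF : ∀ i y, F i y = (Icc (-(cert.b : ℝ)) cert.b).indicator (fun y ↦
        2 * (∫ x, v i x * (Real.cosh (x / 2) : ℂ)) * (Real.cosh (y / 2) : ℂ) -
          2 * (∫ x, v i x * (Real.sinh (x / 2) : ℂ)) * (Real.sinh (y / 2) : ℂ) +
        (∑ n ∈ weilPrimeIndex (cert.b : ℝ), (((ArithmeticFunction.vonMangoldt n : ℝ) / Real.sqrt n : ℝ) : ℂ) *
          (2 * v i y - v i (y - Real.log n) - v i (y + Real.log n))) +
        ∫ t in Ioi 0, (weilArchDensity t : ℂ) * (2 * v i y - v i (y - t) - v i (y + t))) y -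
      (weilMarkovConstant (cert.b : ℝ) : ℂ) * v i y)
    (W : Fin R.length → Fin R.length → ℝ) {lam : ℝ} (hlam : lam < (β : ℝ))
    (hPSD : ∀ α : Fin R.length → ℝ, 0 ≤ ∑ i, ∑ j, α i * α j *
      (((β : ℝ) - lam) * ((weilPoleForm₂ (v i) (v j) + weilDirichletEnergy₂ (cert.b : ℝ) (v i) (v j) -
          weilMarkovConstant (cert.b : ℝ) * ∫ x, (v i x * conj (v j x)).re) - lam * ∫ x, (v i x * conj (v j x)).re) -
        ∫ x, ((F i - ∑ l, W i l • v l) x * conj ((F j - ∑ l, W j l • v l) x)).re)) :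
    lam ≤ weilEvenGroundEnergy (cert.b : ℝ) := by
  refine le_weilEvenGroundEnergy_of_forall hb0 fun φ hφ hφs hφe hφn ↦ ?_
  have h := dt_sector_bound_of_checkR₁ cert hcheck hμ (fun i ↦ by rw [hRp i]) hb0 hb2 g hg v F hv hF W hlam hPSD hφ hφs
    (fun x ↦ by simpa using hφe x)
  rwa [hφn, mul_one] at h

/-- **`λ ≤ ε_od(b)` from a checked ODD rank-one certificate** (parity `p = 1`) plus the PSD inequality — the parity-ladder
L-side from a low-precision certificate and Ritz data. [cite: WeinsteinStenger1972, Ch. 5 §9 eq. (2) (k = 1: Temple's formula)] -/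
theorem dt_weilOddGroundEnergy_ge_of_checkR₁ (cert : WeilCert23) {β : ℚ} {R : List (ℚ × ℕ × List ℚ)}
    (hcheck : cert.checkR₁ β R 1 = true) (hμ : ∀ i : Fin R.length, 0 ≤ (R.get i).1)
    (hRp : ∀ i : Fin R.length, (R.get i).2.1 % 2 = 1) (hb0 : 0 < (cert.b : ℝ)) (hb2 : (cert.b : ℝ) ≤ Real.log 2)
    (g : Fin R.length → ℝ → ℝ)
    (hg : ∀ i x, g i x = ∑ k ∈ range (cert.base.N + 1), (maskV (R.get i) k : ℝ) * (x / cert.base.a0) ^ k)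
    (v F : Fin R.length → ℝ → ℂ) (hv : ∀ i x, v i x = (((Icc (-(cert.b : ℝ)) cert.b).indicator (g i) x : ℝ) : ℂ))
    (hF : ∀ i y, F i y = (Icc (-(cert.b : ℝ)) cert.b).indicator (fun y ↦
        2 * (∫ x, v i x * (Real.cosh (x / 2) : ℂ)) * (Real.cosh (y / 2) : ℂ) -
          2 * (∫ x, v i x * (Real.sinh (x / 2) : ℂ)) * (Real.sinh (y / 2) : ℂ) +
        (∑ n ∈ weilPrimeIndex (cert.b : ℝ), (((ArithmeticFunction.vonMangoldt n : ℝ) / Real.sqrt n : ℝ) : ℂ) *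
          (2 * v i y - v i (y - Real.log n) - v i (y + Real.log n))) +
        ∫ t in Ioi 0, (weilArchDensity t : ℂ) * (2 * v i y - v i (y - t) - v i (y + t))) y -
      (weilMarkovConstant (cert.b : ℝ) : ℂ) * v i y)
    (W : Fin R.length → Fin R.length → ℝ) {lam : ℝ} (hlam : lam < (β : ℝ))
    (hPSD : ∀ α : Fin R.length → ℝ, 0 ≤ ∑ i, ∑ j, α i * α j *
      (((β : ℝ) - lam) * ((weilPoleForm₂ (v i) (v j) + weilDirichletEnergy₂ (cert.b : ℝ) (v i) (v j) -
          weilMarkovConstant (cert.b : ℝ) * ∫ x, (v i x * conj (v j x)).re) - lam * ∫ x, (v i x * conj (v j x)).re) -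
        ∫ x, ((F i - ∑ l, W i l • v l) x * conj ((F j - ∑ l, W j l • v l) x)).re)) :
    lam ≤ weilOddGroundEnergy (cert.b : ℝ) := by
  refine le_weilOddGroundEnergy_of_forall hb0 fun φ hφ hφs hφo hφn ↦ ?_
  have h := dt_sector_bound_of_checkR₁ cert hcheck hμ (fun i ↦ by rw [hRp i]) hb0 hb2 g hg v F hv hF W hlam hPSD hφ hφs
    (fun x ↦ by simpa using hφo x)
  rwa [hφn, mul_one] at h

/-! ## The all-finite-data form: checked moment certificate + rational PSD certificate + `k²` enclosures -/

/-- **`λ ≤ ε_ev(b)` from finite data**: a checked EVEN rank-one moment certificate (`checkR₁ … 0 = true`), rational PSD data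
`P = δ·1 + Lᵀ diag(D) L`, `D ≥ 0`, error budget `Σ_j E_ij, Σ_i E_ij ≤ δ`, and the `k²` validated enclosures
`|M_ij − P_ij| ≤ E_ij` of the Temple matrix `M_ij = (β−λ)(A_ij − λG_ij) − R^W_ij` of the polynomial trial vectors.
[cite: WeinsteinStenger1972, Ch. 5 §9 eq. (2) (k = 1: Temple's formula)] -/
theorem dt_weilEvenGroundEnergy_ge_of_certificates (cert : WeilCert23) {β : ℚ} {R : List (ℚ × ℕ × List ℚ)}
    (hcheck : cert.checkR₁ β R 0 = true) (hμ : ∀ i : Fin R.length, 0 ≤ (R.get i).1)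
    (hRp : ∀ i : Fin R.length, (R.get i).2.1 % 2 = 0) (hb0 : 0 < (cert.b : ℝ)) (hb2 : (cert.b : ℝ) ≤ Real.log 2)
    (g : Fin R.length → ℝ → ℝ)
    (hg : ∀ i x, g i x = ∑ k ∈ range (cert.base.N + 1), (maskV (R.get i) k : ℝ) * (x / cert.base.a0) ^ k)
    (v F : Fin R.length → ℝ → ℂ) (hv : ∀ i x, v i x = (((Icc (-(cert.b : ℝ)) cert.b).indicator (g i) x : ℝ) : ℂ))
    (hF : ∀ i y, F i y = (Icc (-(cert.b : ℝ)) cert.b).indicator (fun y ↦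
        2 * (∫ x, v i x * (Real.cosh (x / 2) : ℂ)) * (Real.cosh (y / 2) : ℂ) -
          2 * (∫ x, v i x * (Real.sinh (x / 2) : ℂ)) * (Real.sinh (y / 2) : ℂ) +
        (∑ n ∈ weilPrimeIndex (cert.b : ℝ), (((ArithmeticFunction.vonMangoldt n : ℝ) / Real.sqrt n : ℝ) : ℂ) *
          (2 * v i y - v i (y - Real.log n) - v i (y + Real.log n))) +
        ∫ t in Ioi 0, (weilArchDensity t : ℂ) * (2 * v i y - v i (y - t) - v i (y + t))) y -
      (weilMarkovConstant (cert.b : ℝ) : ℂ) * v i y)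
    (W : Fin R.length → Fin R.length → ℝ) {lam : ℝ} (hlam : lam < (β : ℝ)) {m : ℕ}
    (P E : Fin R.length → Fin R.length → ℚ) (D : Fin m → ℚ) (L : Fin m → Fin R.length → ℚ) (δ : ℚ)
    (hE : ∀ i j, |(((β : ℝ) - lam) * ((weilPoleForm₂ (v i) (v j) + weilDirichletEnergy₂ (cert.b : ℝ) (v i) (v j) -
          weilMarkovConstant (cert.b : ℝ) * ∫ x, (v i x * conj (v j x)).re) - lam * ∫ x, (v i x * conj (v j x)).re) -
        ∫ x, ((F i - ∑ l, W i l • v l) x * conj ((F j - ∑ l, W j l • v l) x)).re) - P i j| ≤ E i j)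
    (hrow : ∀ i, ∑ j, E i j ≤ δ) (hcol : ∀ j, ∑ i, E i j ≤ δ) (hD : ∀ r, 0 ≤ D r)
    (hP : ∀ i j, P i j = δ * (if i = j then 1 else 0) + ∑ r, D r * L r i * L r j) :
    lam ≤ weilEvenGroundEnergy (cert.b : ℝ) :=
  dt_weilEvenGroundEnergy_ge_of_checkR₁ cert hcheck hμ hRp hb0 hb2 g hg v F hv hF W hlam
    (dt_psd_of_certificate (fun i j ↦ ((β : ℝ) - lam) * ((weilPoleForm₂ (v i) (v j) +
        weilDirichletEnergy₂ (cert.b : ℝ) (v i) (v j) - weilMarkovConstant (cert.b : ℝ) * ∫ x, (v i x * conj (v j x)).re) -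
        lam * ∫ x, (v i x * conj (v j x)).re) -
      ∫ x, ((F i - ∑ l, W i l • v l) x * conj ((F j - ∑ l, W j l • v l) x)).re) P E D L δ hE hrow hcol hD hP)

/-- **`λ ≤ ε_od(b)` from finite data** (ODD sector, `checkR₁ … 1 = true`): the parity-ladder L-side certificate format in full.
[cite: WeinsteinStenger1972, Ch. 5 §9 eq. (2) (k = 1: Temple's formula)] -/
theorem dt_weilOddGroundEnergy_ge_of_certificates (cert : WeilCert23) {β : ℚ} {R : List (ℚ × ℕ × List ℚ)}
    (hcheck : cert.checkR₁ β R 1 = true) (hμ : ∀ i : Fin R.length, 0 ≤ (R.get i).1)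
    (hRp : ∀ i : Fin R.length, (R.get i).2.1 % 2 = 1) (hb0 : 0 < (cert.b : ℝ)) (hb2 : (cert.b : ℝ) ≤ Real.log 2)
    (g : Fin R.length → ℝ → ℝ)
    (hg : ∀ i x, g i x = ∑ k ∈ range (cert.base.N + 1), (maskV (R.get i) k : ℝ) * (x / cert.base.a0) ^ k)
    (v F : Fin R.length → ℝ → ℂ) (hv : ∀ i x, v i x = (((Icc (-(cert.b : ℝ)) cert.b).indicator (g i) x : ℝ) : ℂ))
    (hF : ∀ i y, F i y = (Icc (-(cert.b : ℝ)) cert.b).indicator (fun y ↦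
        2 * (∫ x, v i x * (Real.cosh (x / 2) : ℂ)) * (Real.cosh (y / 2) : ℂ) -
          2 * (∫ x, v i x * (Real.sinh (x / 2) : ℂ)) * (Real.sinh (y / 2) : ℂ) +
        (∑ n ∈ weilPrimeIndex (cert.b : ℝ), (((ArithmeticFunction.vonMangoldt n : ℝ) / Real.sqrt n : ℝ) : ℂ) *
          (2 * v i y - v i (y - Real.log n) - v i (y + Real.log n))) +
        ∫ t in Ioi 0, (weilArchDensity t : ℂ) * (2 * v i y - v i (y - t) - v i (y + t))) y -
      (weilMarkovConstant (cert.b : ℝ) : ℂ) * v i y)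
    (W : Fin R.length → Fin R.length → ℝ) {lam : ℝ} (hlam : lam < (β : ℝ)) {m : ℕ}
    (P E : Fin R.length → Fin R.length → ℚ) (D : Fin m → ℚ) (L : Fin m → Fin R.length → ℚ) (δ : ℚ)
    (hE : ∀ i j, |(((β : ℝ) - lam) * ((weilPoleForm₂ (v i) (v j) + weilDirichletEnergy₂ (cert.b : ℝ) (v i) (v j) -
          weilMarkovConstant (cert.b : ℝ) * ∫ x, (v i x * conj (v j x)).re) - lam * ∫ x, (v i x * conj (v j x)).re) -
        ∫ x, ((F i - ∑ l, W i l • v l) x * conj ((F j - ∑ l, W j l • v l) x)).re) - P i j| ≤ E i j)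
    (hrow : ∀ i, ∑ j, E i j ≤ δ) (hcol : ∀ j, ∑ i, E i j ≤ δ) (hD : ∀ r, 0 ≤ D r)
    (hP : ∀ i j, P i j = δ * (if i = j then 1 else 0) + ∑ r, D r * L r i * L r j) :
    lam ≤ weilOddGroundEnergy (cert.b : ℝ) :=
  dt_weilOddGroundEnergy_ge_of_checkR₁ cert hcheck hμ hRp hb0 hb2 g hg v F hv hF W hlam
    (dt_psd_of_certificate (fun i j ↦ ((β : ℝ) - lam) * ((weilPoleForm₂ (v i) (v j) +
        weilDirichletEnergy₂ (cert.b : ℝ) (v i) (v j) - weilMarkovConstant (cert.b : ℝ) * ∫ x, (v i x * conj (v j x)).re) -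
        lam * ∫ x, (v i x * conj (v j x)).re) -
      ∫ x, ((F i - ∑ l, W i l • v l) x * conj ((F j - ∑ l, W j l • v l) x)).re) P E D L δ hE hrow hcol hD hP)

end Summit.RiemannHypothesis.RiemannHypothesis.Theorems.EvenWinsBeyondArch

end
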